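import Summits.BirchSwinnertonDyer.Rank1Residual.Supersingular.RankZeroKimTamDefectRecords
import Summits.BirchSwinnertonDyer.Rank1Residual.Supersingular.RankZeroSurjThreeCertificates_04
import HarnessLib

/-!
# N5@3's TAM-DEFECT row (X7@3 ∧ `r_an = 0` ∧ surj(3) ∧ `ord₃ ∏c_ℓ = 1`): the level-`𝒩₂` Kurihara-number RECORD SHAPE for
# class X7 (the twin of gen 21's X8 shape `X8RankZero.bsdp_three_of_kim2025_OPEN_of_ainvs_of_kuriharaNumber_ne_zero_pair`) and
# the RECORD of the one open cell 4675j1 from iw-2's ENGINE K v1.3 depth-2 (cell `b2b-bsdres`, supersingular family prover B =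
# unit `b2b-bsdres-additive-p3`, gen 23; X7 joint pair, B side; class lead N6·O3)

HONEST FRAMING (run/shared/lean/b2b/bsd-rank1-residual/, verbatim in every file): the goal of the
cell is to DELETE the COMBINATION-SHAPED residual classes of the Birch–Swinnerton-Dyer formula for
ALL analytic-rank `≤ 1` elliptic curves over `ℚ` — "full BSD formula for every rank `≤ 1` curve in
class `C`" assembled STRICTLY from published theorems — so that the rank-`≤ 1` remainder becomes
exactly the CONSTRUCTION-SHAPED classes, which are TYPED (missing-input `Prop`s), NOT attempted.
This is not "finishing BSD". X7 stays CONSTRUCTION-SHAPED; THEOREMS ONLY (compositions of tree theorems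
BY NAME; no definition, no named fact, debt 0); per pair; NOT a class theorem; nothing is booked; N5's
marks do not move. Every theorem is CONDITIONAL on the ANNOUNCED preprint C.-H. Kim (app. R. Pollack),
arXiv:2505.09121 Thm. 1.1 (`hK25s`, OPEN binder) and on Wuthrich 2014 Prop. 21 (`hW`, PUBLISHED); `h3per`,
`hGZK`, `hmod` PUBLISHED.

## Why

Gen 21's `RankZeroKimTamDefectRecords.lean` (p308350) turned gen 18's boundary theorem (on a good-3 ∧ tower
∧ `r_an = 0` row, `BSD(E,3) ⟺ ∃` ONE Kurihara number `≢ 0 (mod 3^k)` at a CYCLIC `n ∈ 𝒩_k`, `k ≤ ord₃∏c + 1`;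
the `≥` half of Conj. 1.10 being a THEOREM from Wuthrich there) into a literal-equation record shape for
class X8 and recorded N6's four window TAM-DEFECT cells. Gen 22 left N5@3's single TAM-DEFECT analogue —
4675j1 (X7 at 3, `a_3 = 0`, `∏c_ℓ = 3`, `#Ш_an = 9`) — un-offered: engine K's level-`𝒩₁` numbers vanish
there (Tamagawa exponent 1). iw-2's ENGINE K v1.3 GEN 12 (population R0k2, `q = 9`, `ν = 2`;
`HOME/b2b-bsdres-iw-2/ENGINE-K-P9.md` §4, `tables/engKp9_levels.tsv`, kit j136945) now reads
`δ̃_n ≡ 3 (mod 9)` at the cyclic level `n = 32167 = 19·1693 ∈ 𝒩₂` (levels 10279, 27037 vanish mod 9 —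
no information). This file gives the X7 shape (gen 21's
`X7.bsdp_three_of_kim2025_OPEN_of_wuthrich_of_kuriharaNumber_ne_zero_of_surj` under the literal-equation
preamble) and that record.

## What

* §1 `X7.bsdp_three_rankZero_of_kim2025_OPEN_of_ainvs_of_kuriharaNumber_ne_zero_pair` — for an integer
  equation `[a₁,…,a₆]`: `hmin` (explicit), `3 ∤ Δ`, `countPoints [a] 3 = n₃` with `3 ∣ 3 + 1 − n₃` and an
  ADDITIVE prime `q' ∣ Δ`, `q' ∣ c₄` (class X7, gen 20's `classX7_of_intModel`); two distinct primes
  `ℓ₁, ℓ₂ ≥ 5`, `ℓᵢ ∤ Δ`, `ℓᵢ ≡ 1 (mod 3^k)`, `#(E mod ℓᵢ)(𝔽_ℓᵢ) = mᵢ`, `3^k ∣ mᵢ`, cube tests — ALL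
  kernel-decidable; binders `hsurj` (gen 21's certificate `surj_x7r0_<label>_3`), `r_an = 0`, `D`,
  `k ≤ ord₃ ∏c_ℓ + 1` (Cremona), a `ψ` surjective at both primes and `kuriharaNumber D.f (3^k) n ψ ≠ 0`.
* §2 RECORD `bsdp_x7r0kim9_4675j1` (k = 2).

References: [Kim2025RefinedTNC] Thm. 1.1, §8.1.2 (ANNOUNCED, OPEN binder); [Kim2022StructureSelmer] §1.2.2,
Conj. 1.10; [Wuthrich2014] Lemma 20 (p. 399), Prop. 21 (p. 400); [SilvermanAEC2009] III.1, VII.1, VII.5;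
[IrelandRosen1990] Prop. 5.1.2; [Cremona2006] Table 1; [Miller2011LMS] Def. 1.1.
-/

set_option autoImplicit false

noncomputable section

open scoped Classical MatrixGroups ModularForm

open CongruenceSubgroup WeierstrassCurve Literature.NumberTheory.EllipticCurves
  Literature.NumberTheory.EllipticCurves.ModularForms
  Literature.NumberTheory.EllipticCurves.Rank1Residual
  Literature.NumberTheory.EllipticCurves.Rank1Residual.Typed
  Literature.NumberTheory.EllipticCurves.Rank1Residual.X11RankOneCertificates
  Literature.NumberTheory.EllipticCurves.Wuthrich2014
  Summit.BirchSwinnertonDyer.BirchSwinnertonDyer.Rank1Residual.IntModel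
  Summit.BirchSwinnertonDyer.BirchSwinnertonDyer.Rank1Residual.X11RankOne
  Summit.BirchSwinnertonDyer.Rank1Residual.X11b
  Summit.BirchSwinnertonDyer.Rank1Residual.Additive

namespace Summit.BirchSwinnertonDyer.Rank1Residual.Supersingular

/-! ### §1 The literal-equation RECORD SHAPE (X7@3 ∧ `r_an = 0`, level `ℓ₁ℓ₂ ∈ 𝒩_k` cyclic, `k ≤ ord₃∏c_ℓ + 1`) -/

section Literal

/-- **RECORD SHAPE (N5@3's TAM-DEFECT rows; any `k ≤ ord₃∏c_ℓ + 1`).** For an integer equation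
`[a₁,…,a₆]`: `hmin` global minimality (explicit), `3 ∤ Δ`, `countPoints [a] 3 = n₃` with `3 ∣ 3 + 1 − n₃`
and an ADDITIVE prime `q'` (`q' ∣ Δ`, `q' ∣ c₄`; class X7); two distinct primes `ℓ₁, ℓ₂ ≥ 5`, `ℓᵢ ∤ Δ`,
`ℓᵢ ≡ 1 (mod 3^k)`, `#(E mod ℓᵢ)(𝔽_ℓᵢ) = mᵢ`, `3^k ∣ mᵢ`, cube tests `(Δ : ℤ/ℓᵢ) ≠ 0`, `(Δ : ℤ/ℓᵢ)^{(ℓᵢ−1)/3} ≠ 1`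
— ALL kernel-decidable (the prime facts are the named instance binders `hℓ₁`, `hℓ₂`); the level
`n = ℓ₁ℓ₂` as a literal with `[hn0 : NeZero n]`; binders: `hsurj` (gen 21's certificate), `r_an = 0`, `D`,
`k ≤ ord₃ ∏c_ℓ + 1` (Cremona), a `ψ` surjective at both primes and `kuriharaNumber D.f (3^k) n ψ ≠ 0` ⇒
**`BSD(E,3)`** (gen 21's `X7.bsdp_three_of_kim2025_OPEN_of_wuthrich_of_kuriharaNumber_ne_zero_of_surj`).
CONDITIONAL on `hK25s` (OPEN) + `hW` (PUBLISHED). X7 joint pair, B side. Per pair; NOT a class theorem;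
nothing booked. [claim: Kim2025RefinedTNC, status: under-review]
[cite: Kim2025RefinedTNC, Thm. 1.1, §8.1.2 (ANNOUNCED, OPEN binder)] [cite: Wuthrich2014, Lemma 20 (p. 399) and Prop. 21 (p. 400)]
[cite: Kim2022StructureSelmer, §1.2.2 and Thm. 1.10 (1)] [cite: SilvermanAEC2009, III.1, VII.1 Remark 1.1, VII.5 Prop. 5.1(a) and (c)]
[cite: IrelandRosen1990, Prop. 5.1.2 and §8.1] [cite: Miller2011LMS, Def. 1.1] -/
theorem X7.bsdp_three_rankZero_of_kim2025_OPEN_of_ainvs_of_kuriharaNumber_ne_zero_pair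
    (hK25s : Kim2025.thm11_kimShaLength_of_integralPeriod_OPEN) (hW : sha_dvd_analyticSha)
    (hGZK : rank_eq_analyticRank_of_analyticRank_le_one) (hmod : hasEntireLFunction_rat)
    (h3per : realPeriodRat_eq_unit_mul_plusPeriod_three)
    (a1 a2 a3 a4 a6 : ℤ) (hmin : (⟨a1, a2, a3, a4, a6⟩ : WeierstrassCurve ℚ).IsGloballyMinimal)
    (h3Δ : ¬ (3 : ℤ) ∣ discOf [a1, a2, a3, a4, a6]) {n₃ : ℕ}
    (hc₃ : countPoints [a1, a2, a3, a4, a6] 3 = n₃) (ha₃ : (3 : ℤ) ∣ (3 : ℤ) + 1 - n₃)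
    (q' : ℕ) (hq' : q'.Prime) (hqΔ : (q' : ℤ) ∣ discOf [a1, a2, a3, a4, a6])
    (hqc₄ : (q' : ℤ) ∣ c4Of [a1, a2, a3, a4, a6])
    (hsurj : Surj (⟨a1, a2, a3, a4, a6⟩ : WeierstrassCurve ℚ) 3)
    (hr : (⟨a1, a2, a3, a4, a6⟩ : WeierstrassCurve ℚ).analyticRank = 0)
    {N : ℕ} [NeZero N] (D : ModularParametrizationData (⟨a1, a2, a3, a4, a6⟩ : WeierstrassCurve ℚ) N)
    {k : ℕ} (hk1 : 1 ≤ k)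
    (hk : k ≤ padicValNat 3 (⟨a1, a2, a3, a4, a6⟩ : WeierstrassCurve ℚ).tamagawaProduct + 1)
    (ℓ₁ ℓ₂ : ℕ) (hne : ℓ₁ ≠ ℓ₂) (h5₁ : 5 ≤ ℓ₁) (h5₂ : 5 ≤ ℓ₂)
    (hΔ₁ : ¬ (ℓ₁ : ℤ) ∣ discOf [a1, a2, a3, a4, a6]) (hΔ₂ : ¬ (ℓ₂ : ℤ) ∣ discOf [a1, a2, a3, a4, a6])
    (h1₁ : ℓ₁ ≡ 1 [MOD 3 ^ k]) (h1₂ : ℓ₂ ≡ 1 [MOD 3 ^ k]) {m₁ m₂ : ℕ}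
    (hcnt₁ : Nat.card (((⟨a1, a2, a3, a4, a6⟩ : WeierstrassCurve ℤ).map
      (Int.castRingHom (ZMod ℓ₁))).toAffine.Point) = m₁)
    (hcnt₂ : Nat.card (((⟨a1, a2, a3, a4, a6⟩ : WeierstrassCurve ℤ).map
      (Int.castRingHom (ZMod ℓ₂))).toAffine.Point) = m₂)
    (hd₁ : 3 ^ k ∣ m₁) (hd₂ : 3 ^ k ∣ m₂)
    (hz₁ : ((discOf [a1, a2, a3, a4, a6] : ℤ) : ZMod ℓ₁) ≠ 0)
    (hχ₁ : ((discOf [a1, a2, a3, a4, a6] : ℤ) : ZMod ℓ₁) ^ ((ℓ₁ - 1) / 3) ≠ 1)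
    (hz₂ : ((discOf [a1, a2, a3, a4, a6] : ℤ) : ZMod ℓ₂) ≠ 0)
    (hχ₂ : ((discOf [a1, a2, a3, a4, a6] : ℤ) : ZMod ℓ₂) ^ ((ℓ₂ - 1) / 3) ≠ 1)
    [hℓ₁ : Fact ℓ₁.Prime] [hℓ₂ : Fact ℓ₂.Prime] (n : ℕ) [hn0 : NeZero n] (hn : ℓ₁ * ℓ₂ = n)
    (ψ : (ℓ : ℕ) → (ZMod ℓ)ˣ →* Multiplicative (ZMod (3 ^ k)))
    (hψ : ∀ ℓ ∈ n.primeFactors, Function.Surjective (ψ ℓ))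
    (hδ : kuriharaNumber D.f (3 ^ k) n ψ ≠ 0) :
    BSDp (⟨a1, a2, a3, a4, a6⟩ : WeierstrassCurve ℚ) 3 := by
  subst hn
  have h0 : discOf [a1, a2, a3, a4, a6] ≠ 0 := fun h ↦ h3Δ (by rw [h]; exact dvd_zero _)
  haveI := isElliptic_of_discOf_ne_zero a1 a2 a3 a4 a6 h0
  haveI := hmin
  haveI : Fact (Nat.Prime 3) := ⟨by norm_num⟩
  have hI : integralModelInt (⟨a1, a2, a3, a4, a6⟩ : WeierstrassCurve ℚ) = ⟨a1, a2, a3, a4, a6⟩ :=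
    integralModelInt_eq_of_map_eq _ (map_mk_int a1 a2 a3 a4 a6)
  have hΔ₁' : ((⟨a1, a2, a3, a4, a6⟩ : WeierstrassCurve ℤ).map (Int.castRingHom (ZMod ℓ₁))).Δ =
      ((discOf [a1, a2, a3, a4, a6] : ℤ) : ZMod ℓ₁) := by
    rw [WeierstrassCurve.map_Δ, intCurve_Δ, eq_intCast]
  have hΔ₂' : ((⟨a1, a2, a3, a4, a6⟩ : WeierstrassCurve ℤ).map (Int.castRingHom (ZMod ℓ₂))).Δ =
      ((discOf [a1, a2, a3, a4, a6] : ℤ) : ZMod ℓ₂) := by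
    rw [WeierstrassCurve.map_Δ, intCurve_Δ, eq_intCast]
  have hX : ClassX7 (⟨a1, a2, a3, a4, a6⟩ : WeierstrassCurve ℚ) 3 :=
    classX7_of_intModel (p := 3) hI (by rw [intCurve_Δ]; exact h3Δ)
      (natCard_point_eq_of_countPoints a1 a2 a3 a4 a6 3 (by decide) h3Δ hc₃) ha₃ q' hq'
      (by rw [intCurve_Δ]; exact hqΔ) (by rw [intCurve_c₄]; exact hqc₄)
  have hprod := isKolyvaginProduct_pair_of_intModel_of_card hI k ℓ₁ ℓ₂ hne (by omega) (by omega)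
    (by rw [intCurve_Δ]; exact hΔ₁) (by rw [intCurve_Δ]; exact hΔ₂) h1₁ h1₂ hcnt₁ hcnt₂ hd₁ hd₂
  have hcyc := isCyclicKolyvaginLevel_pair_of_intModel_of_cube hI hk1 ℓ₁ ℓ₂ hne h5₁ h5₂
    (by rw [intCurve_Δ]; exact hΔ₁) (by rw [intCurve_Δ]; exact hΔ₂) h1₁ h1₂ hcnt₁ hcnt₂ hd₁ hd₂
    (by rw [hΔ₁']; exact hz₁) (by rw [hΔ₁']; exact hχ₁) (by rw [hΔ₂']; exact hz₂) (by rw [hΔ₂']; exact hχ₂)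
  exact X7.bsdp_three_of_kim2025_OPEN_of_wuthrich_of_kuriharaNumber_ne_zero_of_surj _ hK25s hW hGZK hmod
    h3per hr hX hsurj D hcyc hprod hk ψ hψ hδ

end Literal

/-! ### §2 RECORD — N5@3's one open TAM-DEFECT cell (k = 2; iw-2 ENGINE K v1.3 depth-2, population R0k2) -/

section Records

/-- **`4675j1`** (N5@3 TAM-DEFECT: X7@3 ∧ `r_an = 0` ∧ surj(3), `a_3 = 0`, `∏c_ℓ = 3` (`ord₃ = 1`), `#Ш_an = 9`,
`#E(ℚ)_tors = 1`; Cremona model `[0, 0, 1, -70625, -7224219]`, `N = 4675` = 5²·11·17, additive at `5`):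
`BSD(E,3)` from ONE level-`𝒩₂` Kurihara number at `n = 32167 = 19·1693` — KERNEL: `ℓ ≡ 1 (mod 9)` for both
primes, `#Ẽ(𝔽_{19}) = 18` (`a = 2`), `#Ẽ(𝔽_{1693}) = 1719` (`a = −25`), `9 ∣` both counts (so `n ∈ 𝒩₂`), cube
tests `Δ^{(ℓ−1)/3} ≡ 7, 1259 ≢ 1` (cyclic `3`-parts; engine K: `Ẽ(𝔽_ℓ) ≅ ℤ/18`, `ℤ/1719`, `#Ẽ[3] = 3, 3`),
class X7 (`#Ẽ(𝔽₃) = 4`, additive prime `5 ∣ Δ`, `5 ∣ c₄`), minimality, surj(3) (`surj_x7r0_4675j1_3`); BINDERS: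
`htam : 2 ≤ ord₃∏c_ℓ + 1` (Cremona `∏c_ℓ = 3`), `hδ`: iw-2 ENGINE K v1.3 depth-2 (population R0k2,
`tables/engKp9_levels.tsv`, kit j136945; ONE engine at this level; certificates feq ≤ 4.5e-15, round_resid ≤
2.8e-13, dft ≤ 4.1e-12, D = 1): `δ̃_n ≡ 3 (mod 9)` (tower [0, 3], `ord₃ = 1 = ord₃∏c_ℓ` as Conj. 1.10 predicts);
the other two cyclic `𝒩₂` levels run, 10279 = 19·541 and 27037 = 19·1423, vanish mod 9 (no information).
Non-vanishing mod 9 does not depend on the surjective `ψ` (the number is multiplied by a unit when `ψ_ℓ`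
changes), so `hδ` is stated for an arbitrary `ψ` surjective at both primes. CONDITIONAL on `hK25s` (OPEN) +
`hW` (PUBLISHED); `r_an = 0` Cremona. With gen 22's 35 KP3 offers every one of the 36 open N5@3 cells now
carries a Kim-conditional record. Per pair; NOT a class theorem; nothing booked; a second engine at this
level is the ask (iw-2 ENGINE M / cc-eng-6 KURX k = 2). [claim: Kim2025RefinedTNC, status: under-review]
[cite: Kim2025RefinedTNC, Thm. 1.1, §8.1.2 (ANNOUNCED, OPEN binder)] [cite: Wuthrich2014, Prop. 21 (p. 400)]
[cite: Kim2022StructureSelmer, §1.2.2] [cite: Cremona2006, Table 1 (Cremona label 4675j1)] -/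
theorem bsdp_x7r0kim9_4675j1
    (hK25s : Kim2025.thm11_kimShaLength_of_integralPeriod_OPEN) (hW : sha_dvd_analyticSha)
    (hGZK : rank_eq_analyticRank_of_analyticRank_le_one) (hmod : hasEntireLFunction_rat)
    (h3per : realPeriodRat_eq_unit_mul_plusPeriod_three)
    (W : WeierstrassCurve ℚ) (hWeq : W = ⟨0, 0, 1, -70625, -7224219⟩) (hr : W.analyticRank = 0)
    (htam : 2 ≤ padicValNat 3 W.tamagawaProduct + 1)
    {N : ℕ} [NeZero N] (D : ModularParametrizationData W N)
    (ψ : (ℓ : ℕ) → (ZMod ℓ)ˣ →* Multiplicative (ZMod (3 ^ 2)))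
    (hψ : ∀ ℓ ∈ (32167 : ℕ).primeFactors, Function.Surjective (ψ ℓ))
    (hδ : kuriharaNumber D.f (3 ^ 2) 32167 ψ ≠ 0) : BSDp W 3 := by
  subst hWeq
  exact X7.bsdp_three_rankZero_of_kim2025_OPEN_of_ainvs_of_kuriharaNumber_ne_zero_pair hK25s hW hGZK hmod
    h3per 0 0 1 (-70625) (-7224219)
    (isGloballyMinimal_of_krausCriterion_bounded 0 0 1 (-70625) (-7224219)
      (by decide +kernel) (by decide +kernel) (by decide +kernel))
    (by decide) (n₃ := 4) (by decide +kernel) (by decide) 5 (by norm_num) (by decide) (by decide)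
    surj_x7r0_4675j1_3 hr D (k := 2) (by norm_num)
    htam 19 1693 (by norm_num) (by norm_num) (by norm_num) (by decide) (by decide) (by decide) (by decide)
    (m₁ := 18) (m₂ := 1719)
    (by haveI : Fact (Nat.Prime 19) := ⟨by norm_num⟩
        exact natCard_point_eq_of_powForm 0 0 1 (-70625) (-7224219) 19 (by norm_num) (by decide)
          (by decide +kernel))
    (by haveI : Fact (Nat.Prime 1693) := ⟨by norm_num⟩
        exact natCard_point_eq_of_powForm 0 0 1 (-70625) (-7224219) 1693 (by norm_num) (by decide)
          (by decide +kernel))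
    (by decide) (by decide) (by decide +kernel) (by decide +kernel) (by decide +kernel) (by decide +kernel)
    (hℓ₁ := ⟨by norm_num⟩) (hℓ₂ := ⟨by norm_num⟩) 32167 (hn0 := ⟨by norm_num⟩) (by norm_num) ψ hψ hδ

end Records

end Summit.BirchSwinnertonDyer.Rank1Residual.Supersingular

end
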